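import Summits.QuantumFields.BalabanUV.T4Continuum.Support.NE7TangentCorrectorLocal
import Summits.QuantumFields.BalabanUV.T4Continuum.Support.NE7FlatAverageBridge
import HarnessLib

/-!
# NE7CornerCostFar — THE CORNER GAUGE CORRECTOR'S COST ON FAR REGIONS: on the fine sites whose block is at torus block-distance `≥ ℓ + nbRad + 1` from a centre,
# the `ℓ¹` cost `Σ_{x,κ}(‖Λ(x+e_κ)‖ + ‖Λ x‖)` of F254a's corner lift `Λ` is `≤ 2(d+1)·2(d+1)L · ‖Y₁‖_{1, far by ≥ ℓ}` (F254a §2 after a unit shift and the block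
# decomposition of the period box); plus the dictionary entry `rep (blockOf (toT x)) = ⌊x∕L^{k+1}⌋` on the period box

Cell `pub-balaban`, rung (B)+1 sub-cell t4, lineage `b2b-balaban-t4-ne7-p1` (CRUX PROVER NE7 #1 = OWNER of row NE7), generation 89; memo
`t4/b2b-balaban-t4-ne7-p1-g89/COSTING-N1.md` §5 (1).  File F254b (between F254a `NE7TangentCorrectorLocal` and the END F254c `NE7SliceGreenFlatLocalised`).  Over F254a
(`sum_norm_framePot_far_le`), F35 `NE7FlatAverageBridge` (`toT_nsmul_rep`, `toT_boxVec`), lit-balaban's `B5Blocks16.blockOf_bpt`, `B6LowerBound2153Torus.rep_toT ∕ toT_add`,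
and the period-box bookkeeping of `T4AveragingDeficitWallBoundary` (`sum_blocks_eq`, `blockSites_periodBox`, `sum_periodBox_shift`).

WHY.  F254a §1 localises the corrector's cost to `‖Y₁‖_{1,B} + Σ_{x∈B,κ}(‖Λ(x+e_κ)‖ + ‖Λ x‖)`; F254a §2 pays the frame potential at far CORNERS by the far mass of `Y₁`.
This file joins the two on the far FINE regions the localised slice solver letter uses (F252's `Bf`): the shifted term is moved back by one lattice step on the
period box (periodicity), losing one block of margin, and the corner sum is read off the block decomposition (`Λ` vanishes off the corners `L^{k+1}ℤ^{d+1}`).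
WHAT ([folklore]; 0 def, 0 sorry; dimension `d + 1`).
§1 **`rep_blockOf_toT`** — for `x ∈ [0, L^{k+1}N)^{d+1}`: `rep (blockOf (toT x)) = (x_i ∕ L^{k+1})_i` (integer division) — the T4 ↔ torus reading of «the block of a site».
§2 `tsn_ediv_sub_e_le` (a unit step moves the block by at most one), `corner_indicator_sum` (the block decomposition of `Σ_x [far x]‖Λ x‖`),
   **`corner_cost_far_le`** — `Σ_{x ∈ Far(ℓ+nbRad+1)} Σ_κ (‖Λ(x+e_κ)‖ + ‖Λ x‖) ≤ 2(d+1)·(2(d+1)L)·Σ_{y ∈ Far(ℓ)} Σ_μ ‖Y₁ y μ‖`,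
   `Far(s) = {x ∈ [0,L^{k+1}N)^{d+1} : s ≤ |⌊x∕L^{k+1}⌋ − c|_T}`.
HONEST FRAMING (page 1): lattice bookkeeping; nothing of Bałaban's asserted; NOT (APE), NOT ONE-STEP, NOT NE7; spine 0∕9; finite T⁴ rung (B)+1 — NOT infinite volume, NOT
mass gap, NOT `BetaPertH`, NOT Clay.  Continuum YM on T⁴ ⇐ BetaPertH ∧ nine spine estimates (0/9 proved); BetaPertH ⇐ (D1) ∧ (D4) ∧ CAP+tail; G-an2-4 gates asym, D1
and NE2/3/4.
-/

set_option autoImplicit false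

open scoped BigOperators Matrix Matrix.Norms.L2Operator
open Finset

namespace Summit.QuantumFields.BalabanUV.T4Continuum.NE7CornerCostFar

open Literature.MathematicalPhysics.QuantumFieldTheory.Balaban1983to89
open B7Prop1Explicit (Site e e_apply boxVec l1)
open T4AveragingDeficitWall (dirL1)
open T4AveragingDeficitWallBoundary (periodBox mem_periodBox sum_blocks_eq blockSites_periodBox sum_periodBox_shift)
open AveragingDeficitPeriodicCounting (IsPeriodicDir)
open BlockAverageVaryHolo (nbRad)
open NE3TangentFlatStructure (framePot framePot_add_period)
open NE7TangentCorrectorLocal (sum_norm_framePot_far_le)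
open NE7FlatAverageBridge (toT_nsmul_rep toT_boxVec)
open B4TorusKernel.MultiPeriod (torusSupNorm torusSupNorm_nonneg circAbs circAbs_le_abs circAbs_add_mul)
open B6MemberOfCubeV1 (torusSupNorm_sub_le)
open B5Prop11Plancherel (Tor fine)
open B5Block118 (bpt)
open B5Blocks16 (blockOf blockOf_bpt)
open B6LowerBound2153Torus (toT rep toT_rep rep_toT toT_add)
open B6Lemma24Torus (mem_pbox)

noncomputable section

variable {d : ℕ} {n : Type*} [Fintype n] [DecidableEq n]

/-! ## §1 The block of a site of the period box, read on the torus -/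

/-- **`rep (blockOf (toT x)) = ⌊x∕M⌋` ON THE PERIOD BOX** (`M = L^{k+1}`, cubic coarse period `N`): `x = M•⌊x∕M⌋ + boxVec r`, `toT` of which is `bpt (toT ⌊x∕M⌋) r`
(F35 `toT_nsmul_rep`, `toT_boxVec`), and `⌊x∕M⌋ ∈ [0,N)^{d+1}` is its own representative. [folklore] -/
theorem rep_blockOf_toT (M N : ℕ) [NeZero M] [NeZero N] (x : Site (d + 1)) (hx : x ∈ periodBox (d := d + 1) (M * N)) :
    rep (fun _ : Fin (d + 1) => N) (blockOf M (fun _ : Fin (d + 1) => N) (toT (fine M (fun _ : Fin (d + 1) => N)) x))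
      = fun i => x i / (M : ℤ) := by
  have hM : (0 : ℤ) < M := by exact_mod_cast Nat.pos_of_ne_zero (NeZero.ne M)
  set q : Site (d + 1) := fun i => x i / (M : ℤ) with hq
  -- the digit
  have hr : ∀ i, 0 ≤ x i % (M : ℤ) ∧ x i % (M : ℤ) < M := fun i => ⟨Int.emod_nonneg _ hM.ne', Int.emod_lt_of_pos _ hM⟩
  set r : Fin (d + 1) → Fin M := fun i => ⟨(x i % (M : ℤ)).toNat, by have := hr i; omega⟩ with hrdef
  have hdec : x = (M : ℤ) • q + boxVec M r := by
    funext i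
    simp only [Pi.add_apply, Pi.smul_apply, smul_eq_mul, boxVec, hrdef, hq]
    rw [Int.toNat_of_nonneg (hr i).1]
    have h := Int.mul_ediv_add_emod (x i) (M : ℤ)
    linarith
  -- `q ∈ [0,N)^{d+1}`
  have hqbox : q ∈ B6Lemma24Torus.pbox (fun _ : Fin (d + 1) => N) := by
    rw [mem_pbox]
    intro i
    obtain ⟨h0, h1⟩ := mem_periodBox.mp hx i
    refine ⟨Int.ediv_nonneg h0 hM.le, ?_⟩
    rw [Int.ediv_lt_iff_lt_mul hM]
    push_cast at h1 ⊢
    linarith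
  have hrep : rep (fun _ : Fin (d + 1) => N) (toT (fun _ : Fin (d + 1) => N) q) = q := rep_toT _ hqbox
  -- read `toT x` as `bpt`
  have htoT : toT (fine M (fun _ : Fin (d + 1) => N)) x = bpt M (fun _ : Fin (d + 1) => N) (toT (fun _ : Fin (d + 1) => N) q) r := by
    rw [hdec, toT_add, ← hrep, toT_nsmul_rep, toT_boxVec, hrep]
    rfl
  rw [htoT, blockOf_bpt, hrep]

/-! ## §2 The corner cost on far regions -/

section Far

variable (N : ℕ) [NeZero N]

/-- a unit step of the site moves its block by at most one (torus block-distance). [folklore] -/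
theorem tsn_ediv_sub_e_le (M : ℕ) [NeZero M] (x : Site (d + 1)) (κ : Fin (d + 1)) (c : Site (d + 1)) :
    torusSupNorm (fun _ : Fin (d + 1) => N) ((fun i => (x - e κ) i / (M : ℤ)) - c)
      ≤ torusSupNorm (fun _ : Fin (d + 1) => N) ((fun i => x i / (M : ℤ)) - c) + 1 := by
  have hN1 : ∀ i : Fin (d + 1), 1 ≤ (fun _ : Fin (d + 1) => N) i := fun _ => Nat.one_le_iff_ne_zero.mpr (NeZero.ne N)
  have hM : (0 : ℤ) < M := by exact_mod_cast Nat.pos_of_ne_zero (NeZero.ne M)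
  -- the two block vectors differ by at most one in each coordinate
  have hstep : torusSupNorm (fun _ : Fin (d + 1) => N) ((fun i => (x - e κ) i / (M : ℤ)) - fun i => x i / (M : ℤ)) ≤ 1 := by
    unfold torusSupNorm
    refine Finset.sup'_le _ _ fun i _ => ?_
    have h1 := circAbs_le_abs (hN1 i) (((fun j => (x - e κ) j / (M : ℤ)) - fun j => x j / (M : ℤ)) i)
    have h2 : |((fun j => (x - e κ) j / (M : ℤ)) - fun j => x j / (M : ℤ)) i| ≤ 1 := by
      simp only [Pi.sub_apply, e_apply]
      split_ifs
      · -- `(a − 1)/M ∈ {a/M − 1, a/M}`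
        have hup : (x i - 1) / (M : ℤ) ≤ x i / (M : ℤ) := Int.ediv_le_ediv hM (by linarith)
        have hdown : x i / (M : ℤ) - 1 ≤ (x i - 1) / (M : ℤ) := by
          have : x i / (M : ℤ) - 1 = (x i + (-1) * (M : ℤ)) / (M : ℤ) := by rw [Int.add_mul_ediv_right _ _ hM.ne']; ring
          rw [this]
          exact Int.ediv_le_ediv hM (by nlinarith)
        rw [abs_le]; constructor <;> linarith
      · simp
    exact_mod_cast h1.trans h2
  have htri := torusSupNorm_sub_le hN1 (fun i => (x - e κ) i / (M : ℤ)) (fun i => x i / (M : ℤ)) c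
  linarith

omit [NeZero N] in
/-- the corner sum over the period box, against a block predicate: `Σ_{x ∈ [0,MN)^{d+1}} [p ⌊x∕M⌋]·‖Λ x‖ = Σ_{z ∈ [0,N)^{d+1}} [p z]·‖G z‖` for the corner lift `Λ` of
`G` (`Λ(M•z) = G z`, `0` off the corners). [folklore] -/
theorem corner_indicator_sum (M : ℕ) (hM : 1 ≤ M) (G : Site (d + 1) → Matrix n n ℂ) (p : Site (d + 1) → Prop) [DecidablePred p] :
    ∑ x ∈ periodBox (d := d + 1) (M * N),
        (if p (fun i => x i / (M : ℤ)) then ‖(if ∀ i, (M : ℤ) ∣ x i then G (fun i => x i / (M : ℤ)) else 0)‖ else 0)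
      = ∑ z ∈ periodBox (d := d + 1) N, if p z then ‖G z‖ else 0 := by
  classical
  have hMz : (M : ℤ) ≠ 0 := by exact_mod_cast (show M ≠ 0 by omega)
  rw [← blockSites_periodBox M N hM, ← sum_blocks_eq M hM (periodBox N)
    (fun x => if p (fun i => x i / (M : ℤ)) then ‖(if ∀ i, (M : ℤ) ∣ x i then G (fun i => x i / (M : ℤ)) else 0)‖ else 0)]
  refine Finset.sum_congr rfl fun z _ => ?_
  let r₀ : Fin (d + 1) → Fin M := fun _ => ⟨0, hM⟩
  -- the block of every `M•z + boxVec r` is `z`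
  have hdiv : ∀ r : Fin (d + 1) → Fin M, (fun i => ((M : ℤ) • z + boxVec M r) i / (M : ℤ)) = z := by
    intro r
    funext i
    simp only [Pi.add_apply, Pi.smul_apply, smul_eq_mul, boxVec]
    rw [show (M : ℤ) * z i + ((r i : ℕ) : ℤ) = ((r i : ℕ) : ℤ) + z i * (M : ℤ) by ring, Int.add_mul_ediv_right _ _ hMz,
      Int.ediv_eq_zero_of_lt (by positivity) (by exact_mod_cast (r i).isLt), zero_add]
  simp only [hdiv]
  by_cases hp : p z
  · simp only [if_pos hp]
    rw [Finset.sum_eq_single r₀]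
    · have hr₀ : boxVec M r₀ = 0 := by funext κ; simp [boxVec, r₀]
      have hdz : ∀ i, (M : ℤ) ∣ ((M : ℤ) • z + boxVec M r₀) i := fun i => by rw [hr₀, add_zero]; exact ⟨z i, by simp⟩
      rw [if_pos hdz]
    · intro r _ hr
      have hnd : ¬ ∀ i, (M : ℤ) ∣ ((M : ℤ) • z + boxVec M r) i := by
        intro hall
        apply hr
        funext i
        have hi := hall i
        simp only [Pi.add_apply, Pi.smul_apply, smul_eq_mul, boxVec] at hi
        have hri : (M : ℤ) ∣ ((r i : ℕ) : ℤ) := (dvd_add_right (Dvd.intro _ rfl)).mp hi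
        have hlt : ((r i : ℕ) : ℤ) < (M : ℤ) := by exact_mod_cast (r i).isLt
        have h0 : ((r i : ℕ) : ℤ) = 0 := by
          rcases hri with ⟨c', hc⟩
          have hc0 : c' = 0 := by
            by_contra hne
            have : (1 : ℤ) ≤ c' ∨ c' ≤ -1 := by omega
            rcases this with h | h <;>
              nlinarith [show (0 : ℤ) ≤ ((r i : ℕ) : ℤ) by positivity, show (1 : ℤ) ≤ (M : ℤ) by exact_mod_cast hM]
          rw [hc, hc0, mul_zero]
        exact Fin.ext (by exact_mod_cast h0)
      rw [if_neg hnd, norm_zero]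
    · intro h; exact absurd (Finset.mem_univ r₀) h
  · simp only [if_neg hp, Finset.sum_const_zero]

/-- **THE CORNER COST ON FAR REGIONS** (dimension `d + 1 ≥ 2`, `L ≥ 2`, `N ≥ 1`): for `Y₁` `(L^{k+1}N)`-periodic, a centre `c` and a threshold `ℓ`, with
`Far(s) = {x ∈ [0,L^{k+1}N)^{d+1} : s ≤ |⌊x∕L^{k+1}⌋ − c|_T}` and `Λ` the corner lift of `framePot L (k+1) Y₁`:
`Σ_{x ∈ Far(ℓ + nbRad + 1)} Σ_κ (‖Λ(x + e_κ)‖ + ‖Λ x‖) ≤ 2(d+1)·(2(d+1)L)·Σ_{y ∈ Far(ℓ)} Σ_μ ‖Y₁ y μ‖`. [folklore] -/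
theorem corner_cost_far_le [Nonempty n] (hd : 1 ≤ d) {L : ℕ} (hL : 2 ≤ L) (k : ℕ)
    {Y₁ : Site (d + 1) → Fin (d + 1) → Matrix n n ℂ} (hY₁P : IsPeriodicDir Y₁ ((L ^ (k + 1) * N : ℕ) : ℤ)) (c : Site (d + 1)) (ℓ : ℝ) :
    ∑ x ∈ (periodBox (d := d + 1) (L ^ (k + 1) * N)).filter
        (fun x => ℓ + nbRad (d + 1) L + 1 ≤ torusSupNorm (fun _ : Fin (d + 1) => N) ((fun i => x i / ((L ^ (k + 1) : ℕ) : ℤ)) - c)),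
      ∑ κ : Fin (d + 1),
        (‖(fun x : Site (d + 1) => if ∀ i, ((L ^ (k + 1) : ℕ) : ℤ) ∣ x i then framePot L (k + 1) Y₁ (fun i => x i / ((L ^ (k + 1) : ℕ) : ℤ)) else 0) (x + e κ)‖
          + ‖(fun x : Site (d + 1) => if ∀ i, ((L ^ (k + 1) : ℕ) : ℤ) ∣ x i then framePot L (k + 1) Y₁ (fun i => x i / ((L ^ (k + 1) : ℕ) : ℤ)) else 0) x‖)
      ≤ 2 * ((d + 1 : ℕ) : ℝ) * (2 * ((((d + 1 : ℕ) : ℝ)) * L))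
          * ∑ y ∈ (periodBox (d := d + 1) (L ^ (k + 1) * N)).filter
              (fun y => ℓ ≤ torusSupNorm (fun _ : Fin (d + 1) => N) ((fun i => y i / ((L ^ (k + 1) : ℕ) : ℤ)) - c)), ∑ μ : Fin (d + 1), ‖Y₁ y μ‖ := by
  classical
  set M : ℕ := L ^ (k + 1) with hMdef
  have hM1 : 1 ≤ M := Nat.one_le_pow _ _ (by omega)
  haveI : NeZero M := ⟨by omega⟩
  have hMz : ((M : ℕ) : ℤ) ≠ 0 := by exact_mod_cast (show M ≠ 0 by omega)
  have hP1 : 1 ≤ M * N := Nat.one_le_iff_ne_zero.mpr (Nat.mul_ne_zero (by omega) (NeZero.ne N))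
  set Λ : Site (d + 1) → Matrix n n ℂ :=
    fun x => if ∀ i, ((M : ℕ) : ℤ) ∣ x i then framePot L (k + 1) Y₁ (fun i => x i / ((M : ℕ) : ℤ)) else 0 with hΛ
  set far : ℝ → Site (d + 1) → Prop := fun s x => s ≤ torusSupNorm (fun _ : Fin (d + 1) => N) ((fun i => x i / ((M : ℕ) : ℤ)) - c) with hfar
  -- the frame potential is `N`-periodic, hence `Λ` is `MN`-periodic
  have hGP : ∀ (z : Site (d + 1)) (τ : Fin (d + 1)), framePot L (k + 1) Y₁ (z + (N : ℤ) • e τ) = framePot L (k + 1) Y₁ z :=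
    framePot_add_period L (k + 1) Y₁ (P := (N : ℤ)) (fun y τ μ => by have := hY₁P y τ μ; push_cast at this; exact this)
  have hdivshift : ∀ (x : Site (d + 1)) (τ : Fin (d + 1)),
      (fun i => (x + ((M * N : ℕ) : ℤ) • e τ) i / ((M : ℕ) : ℤ)) = (fun i => x i / ((M : ℕ) : ℤ)) + (N : ℤ) • e τ := by
    intro x τ
    funext i
    simp only [Pi.add_apply, Pi.smul_apply, smul_eq_mul, Nat.cast_mul]
    rw [show ((M : ℕ) : ℤ) * N * e τ i = (N * e τ i) * ((M : ℕ) : ℤ) by ring, Int.add_mul_ediv_right _ _ hMz]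
  have hΛP : ∀ (x : Site (d + 1)) (τ : Fin (d + 1)), Λ (x + ((M * N : ℕ) : ℤ) • e τ) = Λ x := by
    intro x τ
    have hiff : (∀ i, ((M : ℕ) : ℤ) ∣ (x + ((M * N : ℕ) : ℤ) • e τ) i) ↔ ∀ i, ((M : ℕ) : ℤ) ∣ x i := by
      refine forall_congr' fun i => ?_
      simp only [Pi.add_apply, Pi.smul_apply, smul_eq_mul, Nat.cast_mul]
      rw [show ((M : ℕ) : ℤ) * N * e τ i = ((M : ℕ) : ℤ) * (N * e τ i) by ring]
      exact dvd_add_left (Dvd.intro _ rfl)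
    by_cases hx : ∀ i, ((M : ℕ) : ℤ) ∣ x i
    · simp only [hΛ]
      rw [if_pos hx, if_pos (hiff.mpr hx), hdivshift, hGP]
    · simp only [hΛ]
      rw [if_neg hx, if_neg (fun h => hx (hiff.mp h))]
  have hfarP : ∀ (s : ℝ) (x : Site (d + 1)) (τ : Fin (d + 1)), far s (x + ((M * N : ℕ) : ℤ) • e τ) ↔ far s x := by
    intro s x τ
    simp only [hfar]
    rw [hdivshift]
    have : torusSupNorm (fun _ : Fin (d + 1) => N) ((fun i => x i / ((M : ℕ) : ℤ)) + (N : ℤ) • e τ - c)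
        = torusSupNorm (fun _ : Fin (d + 1) => N) ((fun i => x i / ((M : ℕ) : ℤ)) - c) := by
      unfold torusSupNorm
      congr 1
      funext j
      simp only [Pi.sub_apply, Pi.add_apply, Pi.smul_apply, smul_eq_mul]
      rw [show x j / ((M : ℕ) : ℤ) + (N : ℤ) * e τ j - c j = (x j / ((M : ℕ) : ℤ) - c j) + (N : ℤ) * e τ j by ring, circAbs_add_mul]
    rw [this]
  -- (i) the shifted term, moved back by one step on the period box
  have hshift : ∀ κ : Fin (d + 1),
      ∑ x ∈ (periodBox (d := d + 1) (M * N)).filter (far (ℓ + nbRad (d + 1) L + 1)), ‖Λ (x + e κ)‖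
        ≤ ∑ x ∈ (periodBox (d := d + 1) (M * N)).filter (far (ℓ + nbRad (d + 1) L)), ‖Λ x‖ := by
    intro κ
    rw [Finset.sum_filter, Finset.sum_filter]
    -- `Σ_x [far(x)]‖Λ(x+e)‖ = Σ_x [far(x − e)]‖Λ x‖`
    have hper : ∀ (x : Site (d + 1)) (τ : Fin (d + 1)),
        (fun y => if far (ℓ + nbRad (d + 1) L + 1) (y - e κ) then ‖Λ y‖ else 0) (x + ((M * N : ℕ) : ℤ) • e τ)
          = (fun y => if far (ℓ + nbRad (d + 1) L + 1) (y - e κ) then ‖Λ y‖ else 0) x := by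
      intro x τ
      simp only
      rw [hΛP, show x + ((M * N : ℕ) : ℤ) • e τ - e κ = (x - e κ) + ((M * N : ℕ) : ℤ) • e τ by abel]
      simp only [hfarP]
    have h := sum_periodBox_shift (M * N) hP1 (g := fun y => if far (ℓ + nbRad (d + 1) L + 1) (y - e κ) then ‖Λ y‖ else 0) hper (e κ)
    simp only [add_sub_cancel_right] at h
    rw [h]
    refine Finset.sum_le_sum fun x _ => ?_
    by_cases hfx : far (ℓ + nbRad (d + 1) L + 1) (x - e κ)
    · have hfx' : far (ℓ + nbRad (d + 1) L) x := by
        simp only [hfar] at hfx ⊢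
        have := tsn_ediv_sub_e_le N M x κ c
        linarith
      rw [if_pos hfx, if_pos hfx']
    · rw [if_neg hfx]; split_ifs <;> positivity
  -- (ii) the unshifted term: a smaller threshold
  have hmono : ∑ x ∈ (periodBox (d := d + 1) (M * N)).filter (far (ℓ + nbRad (d + 1) L + 1)), ‖Λ x‖
      ≤ ∑ x ∈ (periodBox (d := d + 1) (M * N)).filter (far (ℓ + nbRad (d + 1) L)), ‖Λ x‖ := by
    refine Finset.sum_le_sum_of_subset_of_nonneg (fun x hx => ?_) fun _ _ _ => norm_nonneg _
    rw [Finset.mem_filter] at hx ⊢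
    exact ⟨hx.1, by simp only [hfar] at hx ⊢; linarith [hx.2]⟩
  -- (iii) the corner sum against the block predicate
  have hcorner : ∑ x ∈ (periodBox (d := d + 1) (M * N)).filter (far (ℓ + nbRad (d + 1) L)), ‖Λ x‖
      = ∑ z ∈ (periodBox (d := d + 1) N).filter (fun z => ℓ + nbRad (d + 1) L ≤ torusSupNorm (fun _ : Fin (d + 1) => N) (z - c)),
          ‖framePot L (k + 1) Y₁ z‖ := by
    rw [Finset.sum_filter, Finset.sum_filter]
    have h := corner_indicator_sum (n := n) N M hM1 (framePot L (k + 1) Y₁)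
      (fun z => ℓ + nbRad (d + 1) L ≤ torusSupNorm (fun _ : Fin (d + 1) => N) (z - c))
    simp only [hΛ]
    exact h
  -- (iv) F254a §2
  have hfarsum := sum_norm_framePot_far_le (n := n) N hd hL k hY₁P c ℓ
  -- assemble
  have hsumκ : ∀ C : ℝ, ∑ _κ : Fin (d + 1), C = ((d + 1 : ℕ) : ℝ) * C := fun C => by
    rw [Finset.sum_const, Finset.card_univ, Fintype.card_fin, nsmul_eq_mul]
  calc ∑ x ∈ (periodBox (d := d + 1) (M * N)).filter (far (ℓ + nbRad (d + 1) L + 1)), ∑ κ : Fin (d + 1), (‖Λ (x + e κ)‖ + ‖Λ x‖)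
      = ∑ κ : Fin (d + 1), (∑ x ∈ (periodBox (d := d + 1) (M * N)).filter (far (ℓ + nbRad (d + 1) L + 1)), ‖Λ (x + e κ)‖
          + ∑ x ∈ (periodBox (d := d + 1) (M * N)).filter (far (ℓ + nbRad (d + 1) L + 1)), ‖Λ x‖) := by
        rw [Finset.sum_comm]
        exact Finset.sum_congr rfl fun κ _ => Finset.sum_add_distrib
    _ ≤ ∑ _κ : Fin (d + 1), (2 * ∑ z ∈ (periodBox (d := d + 1) N).filter
          (fun z => ℓ + nbRad (d + 1) L ≤ torusSupNorm (fun _ : Fin (d + 1) => N) (z - c)), ‖framePot L (k + 1) Y₁ z‖) := by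
        refine Finset.sum_le_sum fun κ _ => ?_
        rw [← hcorner]
        linarith [hshift κ, hmono]
    _ ≤ ∑ _κ : Fin (d + 1), (2 * ((2 * ((((d + 1 : ℕ) : ℝ)) * L)) * ∑ y ∈ (periodBox (d := d + 1) (M * N)).filter (far ℓ),
          ∑ μ : Fin (d + 1), ‖Y₁ y μ‖)) := by
        refine Finset.sum_le_sum fun κ _ => ?_
        have := hfarsum
        simp only [hfar]
        linarith
    _ = _ := by rw [hsumκ]; ring

end Far

end

end Summit.QuantumFields.BalabanUV.T4Continuum.NE7CornerCostFar
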